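import Summits.ValiantsHypothesis.ValiantsHypothesis.Theorems.NewtonUnitEquationsTwoProductsFormalLogLinearisationDefs

/-!
# Letter forcing under full row coincidence — val-idea-34 g11 (crux stmt-ValiantsHypothesis-5906)

KERNEL FACT (0 sorry). Let `u_j, v_j` be INTERIOR-supported tails (every monomial has both exponents `≥ 1`;
e.g. supports on the digit grid `A_s = {2^a e₁ + 2^b e₂}`) and `D = ∏(1+u_j) − ∏(1+v_j)`. For ANY exponent
`p`, if the rows truncated to the open box `[0,p₀) × [0,p₁)` coincide AS MULTISETS, then

  `coeff_p D = coeff_p (Σ_j u_j) − coeff_p (Σ_j v_j)`   (`coeff_top_tailDiff`)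

— every product monomial at `p` other than a single letter `p` itself is a product of letters lying in the open
box, and the box-truncated products are equal. CONSEQUENCE (`llVisible_subset_letters`): under the hypothesis
`RowCoincidenceBelowLL` of the γ-toy of record `(U1′)` (val-idea-34 g10 rev 3/4, VERDICT #25 ADDENDUM 2) every
LL-visible point is a LETTER, so `DigitGridLLLawGivenRigidity` holds with `C = 1, c = 0` (`#llVisible ≤ s²`,
`digitGridLLLawGivenRigidity_holds`) and even the linear form holds (`#llVisible ≤ s`,
`digitGridLLLawLinearGivenRigidity_holds`: distinct LL-visible letters have distinct `x`-digits).

READING (seat note N5): the typed hypothesis of `(U1′)` is TOO STRONG to test the cascade's count — it is NOT what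
`TruncatedCongruence` (L1) + carry-free UFD deliver (they give multiset coincidence only on the CLASS box
`[0,β^{a*}) × [0,β^{b*})`, not on `[0,p₀) × [0,p₁)`); the honest count question lives in the HOOK between the class
box and `p`, and in base 2 even the class box's top digit column/row deforms (val-neg-1 g8's `E_T` family,
`RowCoincidenceThreeDigitBox.lean`: the hypothesis of `(U1′)` FAILS on base-2 digit-grid instances — consistent with
`llVisible_subset_letters`: any instance with a non-letter LL-visible point violates it).  The corrected toy is typed below
as `RowCoincidenceOnInnerClassBox` / `DigitGridLLLawGivenInnerRigidity` (`(U1″)`, OPEN).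

§0 copies VERBATIM (same names, same bodies) the objects of `Cruxes/TwoProducts/SubboxCascade_val_idea_34_g10.lean`
rev 4 @e230249a06c6 that are needed (`boxTrunc`, `coeff_boxTrunc`, `coeff_one_add_boxTrunc`, `coeff_prod_box_congr`,
`DigitGrid`, `llVisible`, `RowCoincidenceBelowLL`, `DigitGridLLLawGivenRigidity`), because Cruxes modules are not
importable on the farm; the statements proved here are those copies, literally.

Honest frame: bookkeeping + one exact lemma about a TOY; `TwoProducts` / `PlanarCellBound` / `ResidualLawV25` /
`closes` UNMOVED (v25 @c11a592d1404, 1 sorry `stub_residual`). VP ≠ VNP is NOT proved.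
-/

set_option linter.dupNamespace false
set_option linter.unusedVariables false

namespace Summit.ValiantsHypothesis.ValiantsHypothesis.Cruxes.TwoProducts.LetterForcing

open MvPolynomial
open scoped BigOperators
open Summit.ValiantsHypothesis.ValiantsHypothesis.Theorems.NewtonUnitEquations.TwoProducts.FormalLogLinearisation
-- `Finset.antidiagonal` alone resolves to the `Set.IsPWO` antidiagonal of `Data.Finset.MulAntidiagonal`
open Finset.HasAntidiagonal (antidiagonal mem_antidiagonal)

/-! ## §0 Objects copied verbatim from `SubboxCascade_val_idea_34_g10.lean` (rev 4) -/

/-- Box truncation: keep exactly the monomials whose exponent lies in the coordinate box `[0,N) × [0,M)`. -/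
noncomputable def boxTrunc (N M : ℕ) (p : MvPolynomial (Fin 2) ℂ) : MvPolynomial (Fin 2) ℂ :=
  ∑ e ∈ p.support.filter (fun e => e 0 < N ∧ e 1 < M), monomial e (coeff e p)

/-- Coefficients of the box truncation. -/
theorem coeff_boxTrunc (N M : ℕ) (p : MvPolynomial (Fin 2) ℂ) (x : Expo) :
    coeff x (boxTrunc N M p) = if x 0 < N ∧ x 1 < M then coeff x p else 0 := by
  classical
  unfold boxTrunc
  rw [coeff_sum]
  simp only [coeff_monomial]
  rw [Finset.sum_ite_eq' (p.support.filter (fun e => e 0 < N ∧ e 1 < M)) x (fun e => coeff e p)]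
  simp only [Finset.mem_filter, MvPolynomial.mem_support_iff]
  by_cases hx : x 0 < N ∧ x 1 < M
  · by_cases hc : coeff x p = 0
    · simp [hx, hc]
    · simp [hx, hc]
  · simp [hx]

/-- In the box, `1 + boxTrunc u` and `1 + u` have the same coefficients. -/
theorem coeff_one_add_boxTrunc (N M : ℕ) (q : MvPolynomial (Fin 2) ℂ) (x : Expo)
    (hx0 : x 0 < N) (hx1 : x 1 < M) :
    coeff x (1 + boxTrunc N M q) = coeff x (1 + q) := by
  rw [coeff_add, coeff_add, coeff_boxTrunc]
  simp [hx0, hx1]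

/-- Products are congruent modulo the box-complement ideal. -/
theorem coeff_prod_box_congr {m : ℕ} (N M : ℕ) (F G : Fin m → MvPolynomial (Fin 2) ℂ)
    (h : ∀ j, ∀ x : Expo, x 0 < N → x 1 < M → coeff x (F j) = coeff x (G j)) :
    ∀ (s : Finset (Fin m)) (x : Expo), x 0 < N → x 1 < M →
      coeff x (∏ j ∈ s, F j) = coeff x (∏ j ∈ s, G j) := by
  classical
  intro s
  induction s using Finset.induction_on with
  | empty => intro x _ _; simp
  | insert a s ha ih =>
    intro x hx0 hx1
    rw [Finset.prod_insert ha, Finset.prod_insert ha, coeff_mul, coeff_mul]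
    apply Finset.sum_congr rfl
    intro ab hab
    rw [Finset.HasAntidiagonal.mem_antidiagonal] at hab
    have h0 : ab.1 0 + ab.2 0 = x 0 := by
      have := congrArg (fun e : Expo => e 0) hab
      simpa [Finsupp.add_apply] using this
    have h1 : ab.1 1 + ab.2 1 = x 1 := by
      have := congrArg (fun e : Expo => e 1) hab
      simpa [Finsupp.add_apply] using this
    rw [h a ab.1 (by omega) (by omega), ih ab.2 (by omega) (by omega)]

/-- The digit grid `A_s = {2^a e₁ + 2^b e₂ : a, b < s}`. -/
def DigitGrid (s : ℕ) : Set Expo :=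
  {e | ∃ a b : ℕ, a < s ∧ b < s ∧ e 0 = 2 ^ a ∧ e 1 = 2 ^ b}

/-- LL-visible points (strict tops from the open negative quadrant). -/
def llVisible {m : ℕ} (u v : Fin m → MvPolynomial (Fin 2) ℂ) : Set Expo :=
  {l | ∃ ξ : Fin 2 → ℝ, ξ 0 < 0 ∧ ξ 1 < 0 ∧ ValidWeight u v ξ ∧
    IsStrictTop ξ (↑(tailDiff u v).support : Set Expo) l}

/-- Row coincidence below every LL-visible point (the hypothesis of `(U1′)`, verbatim). -/
def RowCoincidenceBelowLL {m : ℕ} (u v : Fin m → MvPolynomial (Fin 2) ℂ) : Prop :=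
  ∀ p ∈ llVisible u v, ∀ N M : ℕ, N ≤ p 0 + 1 → M ≤ p 1 + 1 → (N ≤ p 0 ∨ M ≤ p 1) →
    (Finset.univ.val.map fun j => boxTrunc N M (u j)) = (Finset.univ.val.map fun j => boxTrunc N M (v j))

/-- `(U1′)` verbatim (val-idea-34 g10 rev 3): the LL count in counting shape, GIVEN row coincidence. -/
def DigitGridLLLawGivenRigidity : Prop :=
  ∃ C c : ℕ, ∀ (m s : ℕ) (u v : Fin m → MvPolynomial (Fin 2) ℂ),
    (∀ j, ∀ e ∈ (u j).support, e ∈ DigitGrid s) → (∀ j, ∀ e ∈ (v j).support, e ∈ DigitGrid s) →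
    RowCoincidenceBelowLL u v → (llVisible u v).ncard ≤ C * m ^ c * s ^ 2

/-! ## §1 New statements -/

/-- The LINEAR form of `(U1′)` (not typed by g10; stronger): GIVEN row coincidence, `#llVisible ≤ C·m^c·s`. -/
def DigitGridLLLawLinearGivenRigidity : Prop :=
  ∃ C c : ℕ, ∀ (m s : ℕ) (u v : Fin m → MvPolynomial (Fin 2) ℂ),
    (∀ j, ∀ e ∈ (u j).support, e ∈ DigitGrid s) → (∀ j, ∀ e ∈ (v j).support, e ∈ DigitGrid s) →
    RowCoincidenceBelowLL u v → (llVisible u v).ncard ≤ C * m ^ c * s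

/-- INTERIOR support: every monomial has both exponents `≥ 1` (digit-grid tails are interior). -/
def Interior (q : MvPolynomial (Fin 2) ℂ) : Prop :=
  ∀ e ∈ q.support, 1 ≤ e 0 ∧ 1 ≤ e 1

/-- (corrected toy, OPEN) Row coincidence ON THE INNER CLASS BOX ONLY: for an LL-visible `p` of dyadic class
`(a*, b*)` (`2^{a*} ≤ p₀ < 2^{a*+1}`, `2^{b*} ≤ p₁ < 2^{b*+1}`) the rows truncated to the INNER box
`[0,2^{a*−1}) × [0,2^{b*−1})` — the class box minus its top digit column and top digit row — agree as multisets.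
This, and not `RowCoincidenceBelowLL`, is the idealisation of base-2 rigidity that survives the data of record:
carry-free bases give coincidence on the whole class box by unique factorisation, but in base 2 the TOP-DIGIT
DEFORMATIONS `E_T` of val-neg-1 g8 (`RowCoincidenceThreeDigitBox.lean`: `f_j = g_j + τ_j·X^{(2^{a*−1},y)}` on rows
proportional below, carry `2^{a*−1}+2^{a*−1} = 2^{a*}`) violate coincidence on the class box itself, in the wild and in an
explicit `s = 4, m = 2` witness; RIGID-BOX key RB5 (no miss of type OTHER) is the pre-registered test that exactly this
inner-box coincidence holds in the wild.  For `a* = 0` (resp. `b* = 0`) the inner box is `[0,1) × …` and the condition is empty. -/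
def RowCoincidenceOnInnerClassBox {m : ℕ} (u v : Fin m → MvPolynomial (Fin 2) ℂ) : Prop :=
  ∀ p ∈ llVisible u v, ∀ a b : ℕ, 2 ^ a ≤ p 0 → p 0 < 2 ^ (a + 1) → 2 ^ b ≤ p 1 → p 1 < 2 ^ (b + 1) →
    (Finset.univ.val.map fun j => boxTrunc (2 ^ (a - 1)) (2 ^ (b - 1)) (u j)) =
      (Finset.univ.val.map fun j => boxTrunc (2 ^ (a - 1)) (2 ^ (b - 1)) (v j))

/-- `(U1″)` — the honest γ-toy (OPEN): inner-class-box coincidence ⇒ counting-shape LL law.  Its content sits in the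
THICK HOOK (x-digit `∈ {a*−1, a*}` or y-digit `∈ {b*−1, b*}`): a monomial of the product at a class-`(a*,b*)` point uses
at most 3 + 3 hook letters (base-2 carries: `2·2^{a*} = 4·2^{a*−1} = 2^{a*+1}`), all other letters lie in the inner box
where the two row families agree — so per class `D` is a sum of `≤ 2m^6` hook words times COMMON inner products
(seat note N5 §3).  NOT letter-forced (products of two hook letters reach `p`), NOT vacuous (N5 §4: the top-hook family
`v_j = u_j + d_j` satisfies the hypothesis by construction and realises `[z¹]∏(1+u_j+z·d_j)`). -/
def DigitGridLLLawGivenInnerRigidity : Prop :=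
  ∃ C c : ℕ, ∀ (m s : ℕ) (u v : Fin m → MvPolynomial (Fin 2) ℂ),
    (∀ j, ∀ e ∈ (u j).support, e ∈ DigitGrid s) → (∀ j, ∀ e ∈ (v j).support, e ∈ DigitGrid s) →
    RowCoincidenceOnInnerClassBox u v → (llVisible u v).ncard ≤ C * m ^ c * s ^ 2

/-! ## §2 Interior products -/

theorem interior_of_digitGrid {s : ℕ} {q : MvPolynomial (Fin 2) ℂ}
    (h : ∀ e ∈ q.support, e ∈ DigitGrid s) : Interior q := by
  intro e he
  obtain ⟨a, b, _, _, h0, h1⟩ := h e he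
  refine ⟨?_, ?_⟩
  · rw [h0]; exact Nat.one_le_two_pow
  · rw [h1]; exact Nat.one_le_two_pow

/-- A product of factors `1 + (interior)` has constant coefficient `1` and no other monomial on an axis. -/
theorem coeff_prod_one_add_axis {m : ℕ} (q : Fin m → MvPolynomial (Fin 2) ℂ) (hq : ∀ j, Interior (q j))
    (s : Finset (Fin m)) (f : Expo) (hf : f 0 = 0 ∨ f 1 = 0) :
    coeff f (∏ j ∈ s, (1 + q j)) = if f = 0 then 1 else 0 := by
  classical
  induction s using Finset.induction_on generalizing f with
  | empty =>
    rw [Finset.prod_empty, MvPolynomial.coeff_one]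
    by_cases h : f = 0
    · subst h; simp
    · simp [h, Ne.symm h]
  | insert a s ha ih =>
    rw [Finset.prod_insert ha, add_mul, one_mul, coeff_add, ih f hf, coeff_mul]
    have hzero : ∑ x ∈ antidiagonal f, coeff x.1 (q a) * coeff x.2 (∏ j ∈ s, (1 + q j)) = 0 := by
      apply Finset.sum_eq_zero
      intro x hx
      rw [Finset.HasAntidiagonal.mem_antidiagonal] at hx
      have h0 : x.1 0 + x.2 0 = f 0 := by
        have := congrArg (fun e : Expo => e 0) hx
        simpa [Finsupp.add_apply] using this
      have h1 : x.1 1 + x.2 1 = f 1 := by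
        have := congrArg (fun e : Expo => e 1) hx
        simpa [Finsupp.add_apply] using this
      by_cases hc : coeff x.1 (q a) = 0
      · rw [hc, zero_mul]
      · exfalso
        have hmem : x.1 ∈ (q a).support := MvPolynomial.mem_support_iff.mpr hc
        obtain ⟨hi0, hi1⟩ := hq a x.1 hmem
        rcases hf with hf0 | hf1 <;> omega
    rw [hzero, add_zero]

/-- Coordinates determine an exponent vector of `Fin 2 →₀ ℕ`. -/
theorem expo_eq_of {e f : Expo} (h0 : e 0 = f 0) (h1 : e 1 = f 1) : e = f := by
  ext i
  fin_cases i
  · exact h0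
  · exact h1

/-! ## §3 The letter-forcing lemma -/

/-- KEY LEMMA. For interior tails, the coefficient at `p` of `∏_{j∈s}(1+u_j)` equals the coefficient at `p` of
the product of the rows truncated to the open box `[0,p₀) × [0,p₁)` plus the first-order term `Σ_{j∈s} coeff_p u_j`. -/
theorem coeff_top_prod {m : ℕ} (u : Fin m → MvPolynomial (Fin 2) ℂ) (hu : ∀ j, Interior (u j)) (p : Expo) :
    ∀ s : Finset (Fin m),
      coeff p (∏ j ∈ s, (1 + u j)) =
        coeff p (∏ j ∈ s, (1 + boxTrunc (p 0) (p 1) (u j))) + ∑ j ∈ s, coeff p (u j) := by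
  classical
  -- box agreement between the full and the truncated products
  have hbox : ∀ (s : Finset (Fin m)) (x : Expo), x 0 < p 0 → x 1 < p 1 →
      coeff x (∏ j ∈ s, (1 + u j)) = coeff x (∏ j ∈ s, (1 + boxTrunc (p 0) (p 1) (u j))) :=
    coeff_prod_box_congr (p 0) (p 1) (fun j => 1 + u j) (fun j => 1 + boxTrunc (p 0) (p 1) (u j))
      (fun j x hx0 hx1 => (coeff_one_add_boxTrunc (p 0) (p 1) (u j) x hx0 hx1).symm)
  intro s
  induction s using Finset.induction_on with
  | empty => simp
  | insert a s ha ih =>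
    rw [Finset.prod_insert ha, Finset.prod_insert ha, Finset.sum_insert ha]
    rw [add_mul, one_mul, coeff_add, add_mul, one_mul, coeff_add, ih]
    -- it remains to identify `coeff p (u a * G)` with `coeff p (t a * G_t) + coeff p (u a)`
    have key : coeff p (u a * ∏ j ∈ s, (1 + u j)) =
        coeff p (boxTrunc (p 0) (p 1) (u a) * ∏ j ∈ s, (1 + boxTrunc (p 0) (p 1) (u j))) + coeff p (u a) := by
      rw [coeff_mul, coeff_mul]
      have hp_mem : ((p, (0 : Expo)) : Expo × Expo) ∈ antidiagonal p := by
        rw [mem_antidiagonal]; simp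
      have hsplit : ∀ x ∈ antidiagonal p,
          coeff x.1 (u a) * coeff x.2 (∏ j ∈ s, (1 + u j)) =
            coeff x.1 (boxTrunc (p 0) (p 1) (u a)) * coeff x.2 (∏ j ∈ s, (1 + boxTrunc (p 0) (p 1) (u j))) +
              (if x = (p, 0) then coeff p (u a) else 0) := by
        intro x hx
        rw [Finset.HasAntidiagonal.mem_antidiagonal] at hx
        have h0 : x.1 0 + x.2 0 = p 0 := by
          have := congrArg (fun e : Expo => e 0) hx
          simpa [Finsupp.add_apply] using this
        have h1 : x.1 1 + x.2 1 = p 1 := by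
          have := congrArg (fun e : Expo => e 1) hx
          simpa [Finsupp.add_apply] using this
        rw [coeff_boxTrunc]
        by_cases hB : x.1 0 < p 0 ∧ x.1 1 < p 1
        · -- the letter lies in the open box: the cofactor monomial lies in the box too
          rw [if_pos hB]
          have hne : x ≠ (p, 0) := by
            rintro rfl
            exact lt_irrefl _ hB.1
          rw [if_neg hne, add_zero]
          by_cases hc : coeff x.1 (u a) = 0
          · rw [hc, zero_mul, zero_mul]
          · have hmem : x.1 ∈ (u a).support := MvPolynomial.mem_support_iff.mpr hc
            obtain ⟨hi0, hi1⟩ := hu a x.1 hmem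
            rw [hbox s x.2 (by omega) (by omega)]
        · -- the letter is not in the open box: it is `p` itself or the cofactor sits on an axis and vanishes
          rw [if_neg hB, zero_mul, zero_add]
          have hax : x.2 0 = 0 ∨ x.2 1 = 0 := by
            rcases not_and_or.mp hB with hB' | hB'
            · exact Or.inl (by omega)
            · exact Or.inr (by omega)
          rw [coeff_prod_one_add_axis u hu s x.2 hax]
          by_cases h2 : x.2 = 0
          · have hx1 : x.1 = p := by
              have := hx; rw [h2, add_zero] at this; exact this
            have hx' : x = (p, 0) := Prod.ext hx1 h2
            rw [if_pos h2, if_pos hx', mul_one, hx1]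
          · have hx' : x ≠ (p, 0) := by
              intro h; exact h2 (congrArg Prod.snd h)
            rw [if_neg h2, if_neg hx', mul_zero]
      rw [Finset.sum_congr rfl hsplit, Finset.sum_add_distrib,
        Finset.sum_ite_eq' (antidiagonal p) ((p, (0 : Expo)) : Expo × Expo) (fun _ => coeff p (u a)), if_pos hp_mem]
    rw [key]
    ring

/-- Letter forcing: under multiset coincidence of the rows truncated to `[0,p₀) × [0,p₁)`, the coefficient of
`D = ∏(1+u) − ∏(1+v)` at `p` is the FIRST-ORDER coefficient `[p](Σ u_j − Σ v_j)`. -/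
theorem coeff_top_tailDiff {m : ℕ} (u v : Fin m → MvPolynomial (Fin 2) ℂ)
    (hu : ∀ j, Interior (u j)) (hv : ∀ j, Interior (v j)) (p : Expo)
    (hcoin : (Finset.univ.val.map fun j => boxTrunc (p 0) (p 1) (u j)) =
      (Finset.univ.val.map fun j => boxTrunc (p 0) (p 1) (v j))) :
    coeff p (tailDiff u v) = (∑ j, coeff p (u j)) - ∑ j, coeff p (v j) := by
  classical
  unfold tailDiff
  rw [coeff_sub, coeff_top_prod u hu p Finset.univ, coeff_top_prod v hv p Finset.univ]
  have h1 : (Finset.univ.val.map fun j => (1 : MvPolynomial (Fin 2) ℂ) + boxTrunc (p 0) (p 1) (u j)) =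
      (Finset.univ.val.map fun j => boxTrunc (p 0) (p 1) (u j)).map (fun q => 1 + q) := by
    rw [Multiset.map_map]; rfl
  have h2 : (Finset.univ.val.map fun j => (1 : MvPolynomial (Fin 2) ℂ) + boxTrunc (p 0) (p 1) (v j)) =
      (Finset.univ.val.map fun j => boxTrunc (p 0) (p 1) (v j)).map (fun q => 1 + q) := by
    rw [Multiset.map_map]; rfl
  have hprod : ∏ j, ((1 : MvPolynomial (Fin 2) ℂ) + boxTrunc (p 0) (p 1) (u j)) =
      ∏ j, ((1 : MvPolynomial (Fin 2) ℂ) + boxTrunc (p 0) (p 1) (v j)) := by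
    rw [Finset.prod_eq_multiset_prod, Finset.prod_eq_multiset_prod, h1, h2, hcoin]
  rw [hprod]
  ring

/-! ## §4 Consequences for the γ-toy `(U1′)` -/

/-- Under `RowCoincidenceBelowLL`, every LL-visible point is a letter of some row. -/
theorem llVisible_subset_letters {m s : ℕ} (u v : Fin m → MvPolynomial (Fin 2) ℂ)
    (hu : ∀ j, ∀ e ∈ (u j).support, e ∈ DigitGrid s) (hv : ∀ j, ∀ e ∈ (v j).support, e ∈ DigitGrid s)
    (hR : RowCoincidenceBelowLL u v) :
    ∀ p ∈ llVisible u v, ∃ j, p ∈ (u j).support ∨ p ∈ (v j).support := by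
  classical
  intro p hp
  obtain ⟨ξ, hξ0, hξ1, hval, htop⟩ := hp
  have hpS : p ∈ (tailDiff u v).support := by
    have := htop.1
    simpa using this
  have hcoin := hR p ⟨ξ, hξ0, hξ1, hval, htop⟩ (p 0) (p 1) (by omega) (by omega) (Or.inl le_rfl)
  have hc := coeff_top_tailDiff u v (fun j => interior_of_digitGrid (hu j)) (fun j => interior_of_digitGrid (hv j))
    p hcoin
  have hne : coeff p (tailDiff u v) ≠ 0 := MvPolynomial.mem_support_iff.mp hpS
  rw [hc] at hne
  by_contra hnone'
  have hnone : ∀ j, p ∉ (u j).support ∧ p ∉ (v j).support :=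
    fun j => ⟨fun h => hnone' ⟨j, Or.inl h⟩, fun h => hnone' ⟨j, Or.inr h⟩⟩
  apply hne
  have hu0 : ∑ j, coeff p (u j) = 0 := by
    apply Finset.sum_eq_zero
    intro j _
    exact MvPolynomial.notMem_support_iff.mp (hnone j).1
  have hv0 : ∑ j, coeff p (v j) = 0 := by
    apply Finset.sum_eq_zero
    intro j _
    exact MvPolynomial.notMem_support_iff.mp (hnone j).2
  rw [hu0, hv0, sub_zero]

/-- Under `RowCoincidenceBelowLL`, the LL-visible set lies in the digit grid. -/
theorem llVisible_subset_digitGrid {m s : ℕ} (u v : Fin m → MvPolynomial (Fin 2) ℂ)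
    (hu : ∀ j, ∀ e ∈ (u j).support, e ∈ DigitGrid s) (hv : ∀ j, ∀ e ∈ (v j).support, e ∈ DigitGrid s)
    (hR : RowCoincidenceBelowLL u v) : llVisible u v ⊆ DigitGrid s := by
  intro p hp
  obtain ⟨j, hj | hj⟩ := llVisible_subset_letters u v hu hv hR p hp
  · exact hu j p hj
  · exact hv j p hj

/-- The grid point `2^a e₁ + 2^b e₂`. -/
noncomputable def gridPt (ab : ℕ × ℕ) : Expo :=
  Finsupp.single 0 (2 ^ ab.1) + Finsupp.single 1 (2 ^ ab.2)

theorem digitGrid_subset_image (s : ℕ) :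
    DigitGrid s ⊆ ↑((Finset.range s ×ˢ Finset.range s).image gridPt) := by
  classical
  intro e he
  obtain ⟨a, b, ha, hb, h0, h1⟩ := he
  rw [Finset.coe_image]
  refine ⟨(a, b), ?_, ?_⟩
  · simp [ha, hb]
  · apply expo_eq_of
    · simp [gridPt, Finsupp.add_apply, h0]
    · simp [gridPt, Finsupp.add_apply, h1]

theorem digitGrid_finite (s : ℕ) : (DigitGrid s).Finite :=
  (Finset.finite_toSet _).subset (digitGrid_subset_image s)

/-- The digit grid has at most `s²` points. -/
theorem ncard_digitGrid_le (s : ℕ) : (DigitGrid s).ncard ≤ s ^ 2 := by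
  classical
  calc (DigitGrid s).ncard ≤ (↑((Finset.range s ×ˢ Finset.range s).image gridPt) : Set Expo).ncard :=
        Set.ncard_le_ncard (digitGrid_subset_image s) (Finset.finite_toSet _)
    _ = ((Finset.range s ×ˢ Finset.range s).image gridPt).card := Set.ncard_coe_finset _
    _ ≤ (Finset.range s ×ˢ Finset.range s).card := Finset.card_image_le
    _ = s ^ 2 := by rw [Finset.card_product, Finset.card_range, pow_two]

/-- `(U1′)` HOLDS — with `C = 1`, `c = 0`: every LL-visible point is a letter. -/
theorem digitGridLLLawGivenRigidity_holds : DigitGridLLLawGivenRigidity := by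
  refine ⟨1, 0, fun m s u v hu hv hR => ?_⟩
  have h := Set.ncard_le_ncard (llVisible_subset_digitGrid u v hu hv hR) (digitGrid_finite s)
  have h' := h.trans (ncard_digitGrid_le s)
  simpa using h'

/-- Two distinct LL-visible points have distinct `x`-coordinates (and distinct `y`-coordinates). -/
theorem llVisible_injOn_fst {m : ℕ} (u v : Fin m → MvPolynomial (Fin 2) ℂ) :
    Set.InjOn (fun e : Expo => e 0) (llVisible u v) := by
  intro p hp q hq hpq
  dsimp only at hpq
  obtain ⟨ξ, hξ0, hξ1, _, hptop⟩ := hp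
  obtain ⟨ζ, hζ0, hζ1, _, hqtop⟩ := hq
  by_contra hne
  have hpS : p ∈ (↑(tailDiff u v).support : Set Expo) := hptop.1
  have hqS : q ∈ (↑(tailDiff u v).support : Set Expo) := hqtop.1
  have h1ne : p 1 ≠ q 1 := fun h => hne (expo_eq_of hpq h)
  rcases Nat.lt_or_gt_of_ne h1ne with hlt | hgt
  · -- `p` is coordinatewise below `q`, so `q` cannot be a strict top for a negative weight
    have hw := hqtop.2 p hpS hne
    unfold wt at hw
    have c0 : ((p 0 : ℕ) : ℝ) = ((q 0 : ℕ) : ℝ) := by exact_mod_cast hpq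
    have c0' : ζ 0 * ((p 0 : ℕ) : ℝ) = ζ 0 * ((q 0 : ℕ) : ℝ) := by rw [c0]
    have c1 : ((p 1 : ℕ) : ℝ) < ((q 1 : ℕ) : ℝ) := by exact_mod_cast hlt
    have c2 := mul_lt_mul_of_neg_left c1 hζ1
    linarith
  · have hw := hptop.2 q hqS (Ne.symm hne)
    unfold wt at hw
    have c0 : ((p 0 : ℕ) : ℝ) = ((q 0 : ℕ) : ℝ) := by exact_mod_cast hpq
    have c0' : ξ 0 * ((p 0 : ℕ) : ℝ) = ξ 0 * ((q 0 : ℕ) : ℝ) := by rw [c0]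
    have c1 : ((q 1 : ℕ) : ℝ) < ((p 1 : ℕ) : ℝ) := by exact_mod_cast hgt
    have c2 := mul_lt_mul_of_neg_left c1 hξ1
    linarith

/-- The LINEAR law given rigidity HOLDS — with `C = 1`, `c = 0`: `#llVisible ≤ s`. -/
theorem digitGridLLLawLinearGivenRigidity_holds : DigitGridLLLawLinearGivenRigidity := by
  classical
  refine ⟨1, 0, fun m s u v hu hv hR => ?_⟩
  have hsub := llVisible_subset_digitGrid u v hu hv hR
  have hmaps : ∀ e ∈ llVisible u v, (fun e : Expo => e 0) e ∈ (↑((Finset.range s).image (fun a => 2 ^ a)) : Set ℕ) := by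
    intro e he
    obtain ⟨a, b, ha, hb, h0, h1⟩ := hsub he
    rw [Finset.coe_image]
    exact ⟨a, by simp [ha], h0.symm⟩
  have h := Set.ncard_le_ncard_of_injOn (fun e : Expo => e 0) hmaps (llVisible_injOn_fst u v)
    (Finset.finite_toSet _)
  rw [Set.ncard_coe_finset] at h
  have h' := h.trans (Finset.card_image_le.trans (Finset.card_range s).le)
  simpa using h'

end Summit.ValiantsHypothesis.ValiantsHypothesis.Cruxes.TwoProducts.LetterForcing
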